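import Summits.QuantumFields.YangMills.Theses.FemtoCutoffLadder
import Summits.QuantumFields.YangMills.Theorems.LuscherReductionTwistedTraceScalingTowerOfUniform

/-!
# Route `FemtoCutoffLadder` (QuantumFields / YangMills; rung R2b1 leaf `FemtoTransferGap.FemtoGapOfRecord`) — support item
# `MatchedCouplingExists` (stmt-QuantumFields-23770, the owner's rev-1 repair of stmt-23509 with the depth bound `lam ≤ 1/2`), PROVED

Lead seat `ym-line-fcl-p1` (2026-08-27).  The item is the deep-window matching lemma (also recorded route-side as
`FemtoCutoffLadder.exists_matched_of_window` in `FemtoCutoffLadderMatchedCouplingSmall.lean`): in a window of depth `lam ≤ 1/2` the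
two-loop label `1/ḡ²(β, L)` is `≥ 1` (`TwoLattice.Tower.one_le_invRunningCoupling_of_window`), every label value `≥ 1` is attained on every
lattice at some `β' ≥ 1` (IVT, `TwoLattice.Tower.exists_matched`), and equal labels give the same `Λ` and the same window
(`window_of_matched`, `luscherLambda_eq_of_matched`) — tree lemmas of the `LuscherReduction` fleet, imported from a route-independent module.

HONEST FRAMING: label bookkeeping of the femto rung R2b1; not a transfer-spectrum estimate, not infinite volume, not a mass gap, not Clay.
No definitions, no named facts, no `sorry`.
-/

set_option autoImplicit false

noncomputable section

namespace Summit.QuantumFields.YangMills.Theorems.FemtoCutoffLadder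

open Summit.QuantumFields.YangMills.Theorems.FemtoTransferGap

/-- ★ **THE SUPPORT ITEM `MatchedCouplingExists` (stmt-QuantumFields-23770), PROVED**: for `0 < lam ≤ 1/2`, every window point `(β, L)`
and every `L' ≥ 1` admit `β'` with `(β', L')` in the same window and `Λ(β', L') = Λ(β, L)`. [cite: LuscherMunster1984, §2] -/
theorem matchedCouplingExists_proof : Summit.QuantumFields.YangMills.Theses.FemtoCutoffLadder.MatchedCouplingExists := by
  intro lam hlam hhalf L _ L' _ β hW
  obtain ⟨β', hβ'1, hmatch⟩ :=
    TwoLattice.Tower.exists_matched L' (TwoLattice.Tower.one_le_invRunningCoupling_of_window hlam hhalf hW)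
  exact ⟨β', TwoLattice.Tower.window_of_matched hW hβ'1 hmatch, TwoLattice.Tower.luscherLambda_eq_of_matched hmatch⟩

end Summit.QuantumFields.YangMills.Theorems.FemtoCutoffLadder

end
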